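import Summits.CriticalPhenomena.SAWScalingLimit.Theorems.SAWDevelopingMapObservableToSLETypeLadderBandDefs
import HarnessLib

/-!
# Band success is decided by the exit prefix (band iteration, piece I4)

Stub `stub_bandSuccess_decided` of the crux
`Summit.CriticalPhenomena.SAWScalingLimit.Theses.SAWDevelopingMap.ObservableToSLE`
(item stmt-CriticalPhenomena-10472), line `six-class-type-ladder`, skeleton r16 (band-wise cut of the
abundance residue).

A band of designer levels `S n` lies in the closed `ρout`-ball about the rescaled root `δ·c`; the
vertex list `l` has an entry `l[i]` at distance `> P > ρout` from the rescaled root.  Then the adapted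
band success `BandSuccess Ω δ ρ P S c l` (a clean first exit from some level `S n`, not followed by a
return to `S n` as long as the list has stayed strictly `P`-close to the root since the exit) is a
property of the prefix `l.take (i + 1)` alone.  Elementary list bookkeeping: the exit index `m` is at
most `i` (the far entry `l[i]` is outside every level, while the first `m` entries are inside), the
first-exit data of `l` and of its prefix at an index `m ≤ i` coincide, and the no-return clause only
ever inspects indices `k ≤ i` (an index `k > i` has the far entry `l[i]` among its predecessors after
the exit, so its premise "all predecessors strictly `P`-close" is void).
-/

noncomputable section

open scoped BigOperators Topology NNReal ENNReal Classical
open Filter Set MeasureTheory Metric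
open Literature.Probability.LatticeModels (HexVertex hexGraph hexCenter triZeta Site)
open Literature.Probability.RandomPlanarGeometry
open Literature.Probability.RandomPlanarGeometry.SAW

namespace Summit.CriticalPhenomena.SAWScalingLimit.Theorems.ObservableToSLE.TypeLadder

open Summit.CriticalPhenomena.SAWScalingLimit.Theorems.ObservableToSLER.BridgeGate
  (hexBall HasCleanWindow carvedLaw rowOf)
open Summit.CriticalPhenomena.SAWScalingLimit.Theorems.ObservableToSLER.NestedGate

/-- First-exit data at an index `m ≤ i` are the same for a list `l` and for its prefix
`l.take (i + 1)`: both only read the first `m + 1` entries. -/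
theorem isFirstExitFrom_take_succ_iff {T : Set HexVertex} {l : List HexVertex} {m i : ℕ}
    {p q : HexVertex} (hmi : m ≤ i) :
    IsFirstExitFrom T (l.take (i + 1)) m p q ↔ IsFirstExitFrom T l m p q := by
  have h1 : (l.take (i + 1)).take m = l.take m := by
    rw [List.take_take, min_eq_left (by omega)]
  have h2 : ((l.take (i + 1)).drop m).head? = (l.drop m).head? := by
    rw [List.head?_drop, List.head?_drop, List.getElem?_take_of_lt (by omega)]
  unfold IsFirstExitFrom
  rw [h1, h2]

/-- In a first exit from `T` by the prefix `l.take (i + 1)`, the exit index is at most `i`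
(the entry at the exit index exists in the prefix). -/
theorem le_of_isFirstExitFrom_take_succ {T : Set HexVertex} {l : List HexVertex} {m i : ℕ}
    {p q : HexVertex} (h : IsFirstExitFrom T (l.take (i + 1)) m p q) : m ≤ i := by
  have h' := h.2.1
  rw [List.head?_drop, List.getElem?_eq_some_iff] at h'
  obtain ⟨hm, _⟩ := h'
  rw [List.length_take] at hm
  omega

/-- Registered stub `stub_bandSuccess_decided` (crux item stmt-CriticalPhenomena-10472, skeleton r16,
band iteration piece I4): **band success is decided by the exit prefix.**  If every level `S n` lies in
the closed `ρout`-ball about the rescaled root, `ρout < P`, and the entry `l[i]` is at distance `> P`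
from the rescaled root, then `BandSuccess Ω δ ρ P S c l ↔ BandSuccess Ω δ ρ P S c (l.take (i + 1))`.
(The hypothesis that the earlier entries are `P`-close is part of the registered signature — it says
that `i` is the FIRST far index — but is not needed for the equivalence.) -/
theorem stub_bandSuccess_decided :
    ∀ (Ω : Set ℂ) (δ ρ P ρout : ℝ) (S : ℕ → Set HexVertex) (c : HexVertex) (l : List HexVertex) (i : ℕ)
      (hi : i < l.length),
      (∀ n, ∀ v ∈ S n, dist ((δ : ℂ) * hexCenter v) ((δ : ℂ) * hexCenter c) ≤ ρout) → ρout < P →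
      (∀ (k : ℕ) (hk : k < l.length), k < i →
          dist ((δ : ℂ) * hexCenter (l[k]'hk)) ((δ : ℂ) * hexCenter c) ≤ P) →
      P < dist ((δ : ℂ) * hexCenter (l[i]'hi)) ((δ : ℂ) * hexCenter c) →
      (BandSuccess Ω δ ρ P S c l ↔ BandSuccess Ω δ ρ P S c (l.take (i + 1))) := by
  intro Ω δ ρ P ρout S c l i hi hS hρ _ hfar
  -- the prefix has length `i + 1` and the same entries as `l`
  have hlen : (l.take (i + 1)).length = i + 1 := by
    rw [List.length_take]; omega
  -- the far entry `l[i]` lies outside every level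
  have hnot : ∀ n, l[i] ∉ S n := fun n hmem => by
    have := hS n _ hmem
    linarith
  constructor
  · rintro ⟨n, m, p, q, hfe, hcw, hnr⟩
    -- the exit index is at most `i`: the first `m` entries are inside `S n`, `l[i]` is not
    have hmi : m ≤ i := by
      rcases Nat.lt_or_ge i m with hlt | hge
      · exfalso
        refine hnot n (hfe.2.2.1 _ ?_)
        have hmem : (l.take m)[i]'(by rw [List.length_take]; omega) ∈ l.take m :=
          List.getElem_mem _
        rwa [List.getElem_take] at hmem
      · exact hge
    refine ⟨n, m, p, q, (isFirstExitFrom_take_succ_iff hmi).2 hfe, hcw, ?_⟩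
    intro k hk hmk hclose
    rw [List.getElem_take]
    refine hnr k (by omega) hmk ?_
    intro k' hk' hmk' hk'k
    have := hclose k' (by omega) hmk' hk'k
    rwa [List.getElem_take] at this
  · rintro ⟨n, m, p, q, hfe, hcw, hnr⟩
    have hmi : m ≤ i := le_of_isFirstExitFrom_take_succ hfe
    refine ⟨n, m, p, q, (isFirstExitFrom_take_succ_iff hmi).1 hfe, hcw, ?_⟩
    intro k hk hmk hclose
    rcases Nat.lt_or_ge i k with hik | hki
    · -- `k > i`: the far entry `l[i]` is a predecessor after the exit, contradiction
      exfalso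
      have := hclose i hi hmi hik
      linarith
    · -- `k ≤ i`: an index of the prefix with the same entries
      have := hnr k (by omega) hmk ?_
      · rwa [List.getElem_take] at this
      intro k' hk' hmk' hk'k
      rw [List.getElem_take]
      exact hclose k' (by omega) hmk' hk'k

end Summit.CriticalPhenomena.SAWScalingLimit.Theorems.ObservableToSLE.TypeLadder

end
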